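import Mathlib
import HarnessLib
import Literature.MathematicalPhysics.StatisticalMechanics.FluctuationDefect
import Literature.MathematicalPhysics.StatisticalMechanics.NextHamiltonianBounds

/-!
# `‖A_k^{(q)}H − A_k^{(q')}H‖_{k,0} ≤ (δ/h²)‖H‖_{k,0}` and the two-kernel difference of `H̃ = A_kH + B_kK`
# ([ABKM19] Theorem 6.8 (6.56), Lemma 12.6 (12.51)–(12.53) preparation)

The forward companion of `StepOperatorALipschitz` (which bounds `A(γ)⁻¹ − A(γ')⁻¹`, hypothesis `ha` of
Lemma 12.6): the extracted Hamiltonian `H̃ = nextH D H K = A_kH + B_kK` of the renormalisation step depends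
on the step kernel through `γ = gradCov D.𝒞` and `B_k = opB D`; the two-kernel twin of the step chain
(hypothesis `hl`, crux memo G2-DONE-cgffstiff-g7 §3bis) needs `‖H̃_a − H̃_b‖_{k,0}`:

* `stepOpA_sub_stepOpA_const/lin/quad` — only the constant coefficient of `A(γ)H − A(γ')H` is non-zero,
  `= Σ_q (γ_q − γ'_q) a_q`;
* **`hamNorm_stepOpA_sub_le`** — `‖A(γ)H − A(γ')H‖_{𝔥,R,n} ≤ a‖H‖_{𝔥,R,n}` if `|γ_q − γ'_q| ≤ a(𝔥/R)²`;
* **`hamNorm_stepOpA_sub_abkm_le`** — torus weights: `L^{dk}|γ_q − γ'_q| ≤ δ` gives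
  `‖A(γ)H − A(γ')H‖_{k,0} ≤ (δ/h²)‖H‖_{k,0}`;
* `nextH_sub_nextH_eq` — `H̃_a − H̃_b = (A(γ_a) − A(γ_b))H + (B_a − B_b)K` for two step data sharing `B₀, c₀`;
* **`hamNorm_nextH_kernel_sub_le`** — `‖H̃_a − H̃_b‖_{k,0} ≤ (δ/h²)‖H‖_{k,0} + ‖B_aK − B_bK‖_{k,0}`.

Everything is proved; no named fact.

## References
* S. Adams, S. Buchholz, R. Kotecký, S. Müller, arXiv:1910.13564, Theorem 6.8 (6.55)–(6.57), Lemma 10.5,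
  Lemma 12.6 [AdamsBuchholzKoteckyMuller2019].
-/

noncomputable section

namespace Literature.MathematicalPhysics.StatisticalMechanics.GradientRG

open scoped BigOperators
open Finset

variable {𝕜 : Type*} [NormedField 𝕜] [NormedAlgebra ℝ 𝕜] {d M : ℕ}

/-! ## `A(γ)H − A(γ')H` -/

/-- The constant coefficient of `A(γ)H − A(γ')H` is `Σ_q (γ_q − γ'_q) a_q`. [cite: AdamsBuchholzKoteckyMuller2019, Theorem 6.8 (6.56)] -/
theorem stepOpA_sub_stepOpA_const (γ γ' : quadIndex d → ℝ) (H : RelevantHamiltonian 𝕜 d) (u : Unit) :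
    (stepOpA γ H - stepOpA γ' H) (Sum.inl u) =
      ∑ q : quadIndex d, ((γ q - γ' q : ℝ)) • H (Sum.inr (Sum.inr q)) := by
  rw [Pi.sub_apply, stepOpA_const, stepOpA_const]
  simp only [sub_smul, Finset.sum_sub_distrib]
  abel

/-- The linear coefficients of `A(γ)H − A(γ')H` vanish. [cite: AdamsBuchholzKoteckyMuller2019, Theorem 6.8 (6.56)] -/
theorem stepOpA_sub_stepOpA_lin (γ γ' : quadIndex d → ℝ) (H : RelevantHamiltonian 𝕜 d) (α : linIndex d) :
    (stepOpA γ H - stepOpA γ' H) (Sum.inr (Sum.inl α)) = 0 := by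
  rw [Pi.sub_apply, stepOpA_lin, stepOpA_lin, sub_self]

/-- The quadratic coefficients of `A(γ)H − A(γ')H` vanish. [cite: AdamsBuchholzKoteckyMuller2019, Theorem 6.8 (6.56)] -/
theorem stepOpA_sub_stepOpA_quad (γ γ' : quadIndex d → ℝ) (H : RelevantHamiltonian 𝕜 d) (q : quadIndex d) :
    (stepOpA γ H - stepOpA γ' H) (Sum.inr (Sum.inr q)) = 0 := by
  rw [Pi.sub_apply, stepOpA_quad, stepOpA_quad, sub_self]

/-- **`‖A(γ)H − A(γ')H‖_{𝔥,R,n} ≤ a · ‖H‖_{𝔥,R,n}`** whenever `|γ_q − γ'_q| ≤ a(𝔥/R)²` for all `q`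
(`𝔥, R, a ≥ 0`). [cite: AdamsBuchholzKoteckyMuller2019, Theorem 6.8 (6.56)] -/
theorem hamNorm_stepOpA_sub_le {𝔥 R a : ℝ} (h𝔥 : 0 ≤ 𝔥) (hR : 0 ≤ R) (ha : 0 ≤ a) (n : ℕ)
    {γ γ' : quadIndex d → ℝ} (hγ : ∀ q, |γ q - γ' q| ≤ a * (𝔥 / R) ^ 2) (H : RelevantHamiltonian 𝕜 d) :
    hamNorm 𝔥 R n (stepOpA γ H - stepOpA γ' H) ≤ a * hamNorm 𝔥 R n H := by
  have hn : (0 : ℝ) ≤ n := Nat.cast_nonneg _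
  set cq : quadIndex d → ℝ := fun q => ‖H (Sum.inr (Sum.inr q))‖ with hcq
  have hcq0 : ∀ q, 0 ≤ cq q := fun q => norm_nonneg _
  have hlhs : hamNorm 𝔥 R n (stepOpA γ H - stepOpA γ' H) =
      (n : ℝ) * ‖∑ q : quadIndex d, ((γ q - γ' q : ℝ)) • H (Sum.inr (Sum.inr q))‖ := by
    unfold hamNorm
    simp only [stepOpA_sub_stepOpA_const, stepOpA_sub_stepOpA_lin, stepOpA_sub_stepOpA_quad, norm_zero,
      mul_zero, Finset.sum_const_zero, add_zero]
  rw [hlhs]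
  have hsum : ‖∑ q : quadIndex d, ((γ q - γ' q : ℝ)) • H (Sum.inr (Sum.inr q))‖ ≤
      ∑ q, a * (𝔥 / R) ^ 2 * cq q := by
    refine (norm_sum_le _ _).trans (Finset.sum_le_sum fun q _ => ?_)
    rw [norm_smul, Real.norm_eq_abs]
    exact mul_le_mul_of_nonneg_right (hγ q) (hcq0 q)
  have h1 : (n : ℝ) * ‖∑ q : quadIndex d, ((γ q - γ' q : ℝ)) • H (Sum.inr (Sum.inr q))‖ ≤
      a * (n * ∑ q, (𝔥 / R) ^ 2 * cq q) := by
    calc (n : ℝ) * ‖∑ q : quadIndex d, ((γ q - γ' q : ℝ)) • H (Sum.inr (Sum.inr q))‖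
        ≤ n * ∑ q, a * (𝔥 / R) ^ 2 * cq q := mul_le_mul_of_nonneg_left hsum hn
      _ = a * (n * ∑ q, (𝔥 / R) ^ 2 * cq q) := by
          rw [Finset.mul_sum, Finset.mul_sum, Finset.mul_sum]
          refine Finset.sum_congr rfl fun q _ => ?_; ring
  refine h1.trans (mul_le_mul_of_nonneg_left ?_ ha)
  unfold hamNorm
  have hc0 : 0 ≤ ‖H (Sum.inl ())‖ := norm_nonneg _
  have hlin : 0 ≤ ∑ α : linIndex d, 𝔥 * (R ^ (∑ i, (α : Fin d → ℕ) i))⁻¹ * ‖H (Sum.inr (Sum.inl α))‖ :=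
    Finset.sum_nonneg fun α _ => mul_nonneg (mul_nonneg h𝔥 (inv_nonneg.2 (pow_nonneg hR _))) (norm_nonneg _)
  have : ∑ q, (𝔥 / R) ^ 2 * cq q ≤ ‖H (Sum.inl ())‖ +
      ∑ α : linIndex d, 𝔥 * (R ^ (∑ i, (α : Fin d → ℕ) i))⁻¹ * ‖H (Sum.inr (Sum.inl α))‖ +
      ∑ q : quadIndex d, (𝔥 / R) ^ 2 * ‖H (Sum.inr (Sum.inr q))‖ := by
    simp only [hcq]; linarith
  exact mul_le_mul_of_nonneg_left this hn

/-- **The torus weights**: for `𝔥_k = fieldWt h L d k`, `R_k = L^k`, `n_k = L^{dk}` (`d ≥ 2`, `L ≥ 1`,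
`h > 0`), `L^{dk}|γ_q − γ'_q| ≤ δ` (`δ ≥ 0`) gives `‖A(γ)H − A(γ')H‖_{k,0} ≤ (δ/h²)‖H‖_{k,0}`.
[cite: AdamsBuchholzKoteckyMuller2019, Theorem 6.8 (6.56) / Lemma 12.6] -/
theorem hamNorm_stepOpA_sub_abkm_le {L : ℕ} {h δ : ℝ} (hd : 2 ≤ d) (hL : 1 ≤ L) (hh : 0 < h)
    (hδ : 0 ≤ δ) (k : ℕ) {γ γ' : quadIndex d → ℝ}
    (hγ : ∀ q, ((L ^ (d * k) : ℕ) : ℝ) * |γ q - γ' q| ≤ δ) (H : RelevantHamiltonian 𝕜 d) :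
    hamNorm (fieldWt h L d k) ((L : ℝ) ^ k) (L ^ (d * k)) (stepOpA γ H - stepOpA γ' H) ≤
      (δ / h ^ 2) * hamNorm (fieldWt h L d k) ((L : ℝ) ^ k) (L ^ (d * k)) H := by
  have hL0 : (0 : ℝ) < L := by exact_mod_cast (show 0 < L by omega)
  have hh2 : 0 < h ^ 2 := by positivity
  refine hamNorm_stepOpA_sub_le (fieldWt_pos hh hL0 d k).le (by positivity) (div_nonneg hδ hh2.le) _
    (fun q => ?_) H
  -- `(𝔥_k / L^k)² = 4^k h² / L^{dk} ≥ h² / L^{dk}` and `|γ_q − γ'_q| ≤ δ / L^{dk}`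
  have hsq := fieldWt_sq_mul (h := h) hL0 d k
  rw [hScale_sq] at hsq
  have hLp : (L : ℝ) ^ (d * k) = ((L : ℝ) ^ k) ^ (d - 2) * ((L : ℝ) ^ k) ^ 2 := by
    rw [← pow_mul, ← pow_mul, ← pow_add]; congr 1
    have : d = (d - 2) + 2 := by omega
    conv_lhs => rw [this]
    ring
  have hLdk : (0 : ℝ) < (L : ℝ) ^ (d * k) := by positivity
  have key : (fieldWt h L d k / (L : ℝ) ^ k) ^ 2 = 4 ^ k * h ^ 2 / (L : ℝ) ^ (d * k) := by
    rw [div_pow, hLp, ← hsq]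
    have hne : ((L : ℝ) ^ k) ^ 2 ≠ 0 := by positivity
    have hne' : ((L : ℝ) ^ k) ^ (d - 2) ≠ 0 := by positivity
    field_simp
  rw [key]
  have h4 : (1 : ℝ) ≤ 4 ^ k := one_le_pow₀ (by norm_num)
  have hγ' : |γ q - γ' q| * (L : ℝ) ^ (d * k) ≤ δ := by
    have := hγ q; push_cast at this; linarith [this]
  rw [show δ / h ^ 2 * (4 ^ k * h ^ 2 / (L : ℝ) ^ (d * k)) = δ * 4 ^ k / (L : ℝ) ^ (d * k) by
    field_simp]
  rw [le_div_iff₀ hLdk]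
  nlinarith [abs_nonneg (γ q - γ' q)]

/-! ## The two-kernel difference of `H̃ = A_kH + B_kK` -/

/-- **`H̃_a − H̃_b = (A(γ_a) − A(γ_b))H + (B_a − B_b)K`** for two step data sharing the reference block
and base point (`γ_• = gradCov D_•.𝒞`; both circulants positive semidefinite, room for the test
polynomials). [cite: AdamsBuchholzKoteckyMuller2019, Theorem 6.8 (6.55)–(6.57)] -/
theorem nextH_sub_nextH_eq [NeZero M] (Da Db : StepData d M) (hCa : (Matrix.circulant Da.𝒞).PosSemidef)
    (hCb : (Matrix.circulant Db.𝒞).PosSemidef) (hB : Da.B₀.card ≠ 0)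
    (hroom : ∀ x ∈ Da.B₀, HasRoom Da.c₀ x (d / 2 + 1)) (hB₀ : Db.B₀ = Da.B₀) (hc₀ : Db.c₀ = Da.c₀)
    (H : RelevantHamiltonian ℂ d) (K : Finset (Fin d → ZMod M) → ((Fin d → ZMod M) → ℝ) → ℂ) :
    nextH Da H K - nextH Db H K =
      (stepOpA (gradCov Da.𝒞) H - stepOpA (gradCov Db.𝒞) H) + (opB Da K - opB Db K) := by
  have hB' : Db.B₀.card ≠ 0 := by rw [hB₀]; exact hB
  have hroom' : ∀ x ∈ Db.B₀, HasRoom Db.c₀ x (d / 2 + 1) := by rw [hB₀, hc₀]; exact hroom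
  rw [nextH_eq Da hCa hB hroom H K, nextH_eq Db hCb hB' hroom' H K]
  abel

/-- **`‖H̃_a − H̃_b‖_{k,0} ≤ (δ/h²)‖H‖_{k,0} + ‖B_aK − B_bK‖_{k,0}`** at the torus weights of scale `k`,
from `L^{dk}|γ_q(𝒞a) − γ_q(𝒞b)| ≤ δ` (two step data sharing `B₀, c₀`).
[cite: AdamsBuchholzKoteckyMuller2019, Lemma 12.6 (12.51)–(12.53)] -/
theorem hamNorm_nextH_kernel_sub_le [NeZero M] {L : ℕ} {h δ : ℝ} (hd : 2 ≤ d) (hL : 1 ≤ L) (hh : 0 < h)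
    (hδ : 0 ≤ δ) (k : ℕ) (Da Db : StepData d M) (hCa : (Matrix.circulant Da.𝒞).PosSemidef)
    (hCb : (Matrix.circulant Db.𝒞).PosSemidef) (hB : Da.B₀.card ≠ 0)
    (hroom : ∀ x ∈ Da.B₀, HasRoom Da.c₀ x (d / 2 + 1)) (hB₀ : Db.B₀ = Da.B₀) (hc₀ : Db.c₀ = Da.c₀)
    (hγ : ∀ q, ((L ^ (d * k) : ℕ) : ℝ) * |gradCov Da.𝒞 q - gradCov Db.𝒞 q| ≤ δ)
    (H : RelevantHamiltonian ℂ d) (K : Finset (Fin d → ZMod M) → ((Fin d → ZMod M) → ℝ) → ℂ) :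
    hamNorm (fieldWt h L d k) ((L : ℝ) ^ k) (L ^ (d * k)) (nextH Da H K - nextH Db H K) ≤
      (δ / h ^ 2) * hamNorm (fieldWt h L d k) ((L : ℝ) ^ k) (L ^ (d * k)) H +
        hamNorm (fieldWt h L d k) ((L : ℝ) ^ k) (L ^ (d * k)) (opB Da K - opB Db K) := by
  have hL0 : (0 : ℝ) < L := by exact_mod_cast (show 0 < L by omega)
  rw [nextH_sub_nextH_eq Da Db hCa hCb hB hroom hB₀ hc₀ H K]
  refine (hamNorm_add_le (fieldWt_pos hh hL0 d k).le (by positivity) _ _ _).trans ?_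
  exact add_le_add (hamNorm_stepOpA_sub_abkm_le hd hL hh hδ k hγ H) le_rfl

end Literature.MathematicalPhysics.StatisticalMechanics.GradientRG

end
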